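import Summits.CriticalPhenomena.SAWScalingLimit.Theses.SAWTrackTransport

/-!
# Line `grid_transpose` — alternative registered skeleton for the crux `MirrorRotation`
# (stmt-CriticalPhenomena-16997, rank 7 of `route-CriticalPhenomena-SAWTrackTransport`)

Crux (FIXED): `AngleUniversality → (endpoint approximations at every angle α ∈ [π/3, 2π/3]) →
∀ P chordal, RL(π/2) P → P (c • D) = (c •)_* (P D)` for every `‖c‖ = 1` — DKKMO's reflection trick
(arXiv:2012.11672 §7.1) transposed to chordal families, `RL α P` being the route's robust-full-limit
predicate of the critical constant-angle-`α` Glazman–Manolescu Yang–Baxter walk.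

## Why a second line (strategist, lens `transfer`)

The sibling line `birth` cuts the crux into T (exact lattice mirror equivariance of the finite-volume
law, ONE monolithic combinatorial stub "a sizeable transport API that does not yet exist in the tree"),
M (passage to the robust limit) and R (mirrors generate rotations).  Two things change here.

1. THE TRANSPORT API DOES EXIST: `Literature/…/YangBaxterSAWComplex.lean` (Glazman–Manolescu Prop. 4.2,
   the column-order independence, is proved in the tree THROUGH it) provides rhombic complexes `Cx F E`,
   `Cx.IsWalk`, `Cx.weight`, the lawful grid `gridCx Θ` whose walks ARE the `YBWalk`s
   (`YBWalk.isWalk_mids`, `YBWalk.ofIsWalk`, `weight_gridCx`), and side- and angle-preserving embeddings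
   `Cx.Emb` transporting walks and weights (`Emb.isWalk_map_iff`, `Emb.weight_map`,
   `Emb.walkFinset_eq_image`).  The mirror of the constant-angle tiling is the face TRANSPOSITION
   `(k, j) ↦ (j, k)`, `vert k j ↦ slant j k`, `slant k j ↦ vert j k`; it permutes the side labels
   (`W ↔ S`, `E ↔ N`), so it is not an `Emb (gridCx α) (gridCx α)` — but it IS an
   `Emb (gridCx α) (gridCxᵀ α)` into the TRANSPOSED GRID COMPLEX `gridCxᵀ` (same faces, edges,
   `commonFace`, angle; `side f s := Face.side f (π s)`, `π = (W S)(E N)`), and `gridCxᵀ` has literally the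
   same walks as `gridCx` (the only side-dependent clause, `noncross`, is symmetric in the two straights)
   and the same weights (`arcKind (π s) (π t) = arcKind s t`, 16 cases by `decide`).  So the combinatorial
   heart of T is ONE instantiation of existing Literature API plus two invariance lemmas — stub
   `stub_transposeWalks` below (a weight-preserving `Equiv` of walk types, `mids ↦ mids.map E`).
   The rest of T is plane geometry of the lattice mirror `m_{α,δ} : z ↦ e^{iα} z̄ − (iδ/2)(1 + e^{iα})`
   (`stub_latticeMirrorGeometry`: it intertwines the rescaled mid-edge embedding, transposes the
   discretisation `Ω ↦ Ω_δ`, is within `|δ|` of `m_α : z ↦ e^{iα} z̄`, and is affine on segments) and the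
   Yang–Baxter analogue of the tree's `PinTheShear.map_curve_law_of_iso` (`stub_lawTransport`: a
   weight-preserving equivalence of walk types whose mid-edge map is intertwined by a plane map affine on
   segments pushes `ybLaw … 1` to `ybLaw … 1` after drawing the curves).
2. THE PASSAGE IS MODEL-ABSTRACT: `stub_symmetryPassage` says that ANY exact finite-volume symmetry
   `T_δ → S` (plane homeomorphisms with `dist (T_δ z, S z) ≤ |δ|`, the law of the shifted image domain
   `S D + u_δ`, `‖u_δ‖ ≤ δ`, from relabelled endpoints being `(T_δ)_*` of the law of `D`) passes to a robust
   limit: `P (S D) = S_* (P D)`.  It is stated once for all `α`, `S`, `T`, so the same registered lemma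
   serves the sibling crux `AxiomsOfLimit` (stmt-CriticalPhenomena-16965) for translations
   (`T_δ = · + δ k_δ`, `S = · + w`) and conjugation (`T_δ = S = conj`, `u ≡ 0`) — its stubs
   `stub_translationPassage` / `stub_exactSymmetryPassage` (line `trackTransport_birth`) are two more
   instances of it.

R is kept verbatim (`stub_rotationOfMirrors`, same name and signature as in line `birth`: one landing
serves both lines).

Registration hygiene (the reason the stubs below carry no local `let`): `ledger skeleton check` records a
stub's signature textually up to the first `:=`, so line `birth`'s `stub_mirrorPassage` (which opens with
`let RL : … := fun …`) was registered with the truncated signature `let RL : ℝ → ChordalFamily → Prop`;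
every stub here is `:=`-free before its body and shorter than the 3900-character cap, and is stated over
TREE VOCABULARY ONLY (the mid-edge transposition enters as `∀ E, (∀ k j, E (vert k j) = slant j k) →
(∀ k j, E (slant k j) = vert j k) → …`), so that each lands verbatim as
`Theorems/SAWTrackTransportMirrorRotation<Stub>.lean --supports stmt-CriticalPhenomena-16997`.

`MirrorRotation_of` (kernel-checked, no `sorry` of its own; ≈ 60 lines of glue): for `α ∈ [π/3, 2π/3]`
angle universality gives `RL α P`; `stub_transposeWalks` at the face set `(D.carrier)_δ` composed with
the identity of face sets from `stub_latticeMirrorGeometry` (and the carrier computation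
`(m_α D) + δ c_α = m_{α,δ} D`, `c_α = −(i/2)(1 + e^{iα})`) is an equivalence of walk types
`YBSAW_α(D; a_δ, b_δ) ≃ YBSAW_α(m_α D + δ c_α; E a_δ, E b_δ)`; `stub_lawTransport` turns it into the
finite-volume law identity; `stub_symmetryPassage` (with `S = m_α`, `T_δ = m_{α,δ}`, `u_δ = δ c_α`) gives
`P (m_α D) = (m_α)_* (P D)`; `stub_rotationOfMirrors` composes the mirrors of the interval into every
rotation.  Hypotheses = the five stubs under their registered names; conclusion = the route decl BY NAME.

Disproof used: none exists for this crux (no `Cruxes/MirrorRotation/Disproof.lean`, no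
`Theorems/MirrorRotation/Negative/`; `ledger negatives --problem CriticalPhenomena`: nothing on mirror /
rotation covariance of Yang–Baxter limits; the refuted all-`δ` tightness stmt-0772 is not used — every
clause is eventual in `δ` or at a fixed `δ`).  The refuter's crux-attack (evidence `MirrorCheck.lean`,
2026-08-17) certified exactly the finite facts this line's S1/S2 rest on (`arcKind_mirror`,
`side_mirror`, `sideOf_mirror`, `commonFace_mirror`, `planeMidpoint_mirror`, `colOffset_const`).
-/

noncomputable section

open MeasureTheory Filter Topology
open Literature.Probability.RandomPlanarGeometry
open Literature.Probability.RandomPlanarGeometry.SAW.YangBaxter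

namespace Summit.CriticalPhenomena.SAWScalingLimit.Cruxes.MirrorRotation.GridTranspose

/-! ### Vocabulary of the line -/

/-- The route's robust-full-limit predicate `RL α P` (verbatim the `let RL := …` of
`Theses/SAWTrackTransport.lean`). -/
def RL (α : ℝ) (P : ChordalFamily) : Prop :=
  ∀ (D : DobrushinDomain) (u : ℝ → ℂ) (a b : ℝ → MidEdge), (∀ᶠ δ in 𝓝[>] (0 : ℝ), ‖u δ‖ ≤ δ) →
    (∀ᶠ δ in 𝓝[>] (0 : ℝ), Nonempty (YangBaxterSAW (fun (_ : ℤ) => α)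
      ((D.map (similarity 1 one_ne_zero (u δ))).carrier) δ (a δ) (b δ))) →
    Tendsto (fun δ : ℝ => (δ : ℂ) * planeMidpoint (fun (_ : ℤ) => α) (a δ)) (𝓝[>] (0 : ℝ))
      (𝓝 (D.pt 0)) →
    Tendsto (fun δ : ℝ => (δ : ℂ) * planeMidpoint (fun (_ : ℤ) => α) (b δ)) (𝓝[>] (0 : ℝ))
      (𝓝 (D.pt 1)) →
    TendstoLaw (fun δ (γ : YangBaxterSAW (fun (_ : ℤ) => α)
        ((D.map (similarity 1 one_ne_zero (u δ))).carrier) δ (a δ) (b δ)) =>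
        γ.curve (fun (_ : ℤ) => α) δ)
      (fun δ => ybLaw (fun (_ : ℤ) => α) ((D.map (similarity 1 one_ne_zero (u δ))).carrier) δ 1
        (a δ) (b δ)) id (P D)

/-- The mid-edge transposition `E`: `vert k j ↦ slant j k`, `slant k j ↦ vert j k` (the face
transposition `(k, j) ↦ (j, k)` is `Prod.swap`). -/
def tEdge : MidEdge → MidEdge
  | .vert k j => .slant j k
  | .slant k j => .vert j k

@[simp] theorem tEdge_vert (k j : ℤ) : tEdge (.vert k j) = .slant j k := rfl
@[simp] theorem tEdge_slant (k j : ℤ) : tEdge (.slant k j) = .vert j k := rfl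

/-- `E` is an involution. -/
@[simp] theorem tEdge_tEdge (e : MidEdge) : tEdge (tEdge e) = e := by cases e <;> rfl

/-- The mirror `m_α : z ↦ e^{iα} z̄` across the line `e^{iα/2} ℝ` (spelled as in line `birth`). -/
abbrev mirror (α : ℝ) : ℂ ≃ₜ ℂ :=
  Complex.conjLIE.toHomeomorph.trans
    (similarity (Complex.exp ((α : ℂ) * Complex.I)) (Complex.exp_ne_zero _) 0)

/-- The lattice mirror `m_{α,δ} : z ↦ e^{iα} z̄ − (iδ/2)(1 + e^{iα})`, the exact symmetry of the rescaled
constant-angle-`α` tiling at mesh `δ` (spelled as in line `birth`). -/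
abbrev latticeMirror (α δ : ℝ) : ℂ ≃ₜ ℂ :=
  Complex.conjLIE.toHomeomorph.trans
    (similarity (Complex.exp ((α : ℂ) * Complex.I)) (Complex.exp_ne_zero _)
      (-((δ : ℂ) * Complex.I * (1 + Complex.exp ((α : ℂ) * Complex.I)) / 2)))

/-- The offset `c_α = −(i/2)(1 + e^{iα})`: `m_{α,δ} = m_α + δ c_α`, `‖c_α‖ = cos(α/2) ≤ 1`. -/
def offset (α : ℝ) : ℂ := -(Complex.I * (1 + Complex.exp ((α : ℂ) * Complex.I)) / 2)

/-- Covariance of `P` under the mirror `m_α`. -/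
def MirrorCovariant (α : ℝ) (P : ChordalFamily) : Prop :=
  ∀ D : DobrushinDomain, P (D.map (mirror α)) = (P D).map (CurveClass.map (mirror α : C(ℂ, ℂ)))

/-! ### The five statements, named -/

/-- **S1, named.** The transposition is a weight-preserving equivalence of walk types. -/
def TransposeWalks : Prop :=
  ∀ (E : MidEdge → MidEdge), (∀ k j : ℤ, E (MidEdge.vert k j) = MidEdge.slant j k) →
    (∀ k j : ℤ, E (MidEdge.slant k j) = MidEdge.vert j k) →
    ∀ (α : ℝ) (D : Set Face) (a z : MidEdge),
      ∃ e : YBWalk D a z ≃ YBWalk (Prod.swap '' D) (E a) (E z),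
        ∀ γ : YBWalk D a z, (e γ).mids = γ.mids.map E ∧
          (e γ).weight (fun (_ : ℤ) => α) = γ.weight (fun (_ : ℤ) => α)

/-- **S2, named.** Plane geometry of the lattice mirror `m_{α,δ}`. -/
def LatticeMirrorGeometry : Prop :=
  ∀ (E : MidEdge → MidEdge), (∀ k j : ℤ, E (MidEdge.vert k j) = MidEdge.slant j k) →
    (∀ k j : ℤ, E (MidEdge.slant k j) = MidEdge.vert j k) →
    ∀ (α δ : ℝ),
      (∀ x : MidEdge, (δ : ℂ) * planeMidpoint (fun (_ : ℤ) => α) (E x) =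
        latticeMirror α δ ((δ : ℂ) * planeMidpoint (fun (_ : ℤ) => α) x)) ∧
      (∀ Ω : Set ℂ, meshFaces (fun (_ : ℤ) => α) (latticeMirror α δ '' Ω) δ =
        Prod.swap '' meshFaces (fun (_ : ℤ) => α) Ω δ) ∧
      (∀ z : ℂ, dist (latticeMirror α δ z) (mirror α z) ≤ |δ|) ∧
      (∀ (x y : ℂ) (t : ℝ), latticeMirror α δ (AffineMap.lineMap x y t) =
        AffineMap.lineMap (latticeMirror α δ x) (latticeMirror α δ y) t)

/-- **S3, named.** Transport of the critical finite-volume curve law along a weight-preserving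
equivalence of walk types intertwined by a plane map affine on segments. -/
def LawTransport : Prop :=
  ∀ (Θ : ℤ → ℝ) (δ : ℝ) (Ω Ω' : Set ℂ) (a b a' b' : MidEdge) (E : MidEdge → MidEdge) (F : ℂ ≃ₜ ℂ)
    (e : YangBaxterSAW Θ Ω δ a b ≃ YangBaxterSAW Θ Ω' δ a' b'),
    (∀ (x y : ℂ) (t : ℝ), F (AffineMap.lineMap x y t) = AffineMap.lineMap (F x) (F y) t) →
    (∀ x : MidEdge, (δ : ℂ) * planeMidpoint Θ (E x) = F ((δ : ℂ) * planeMidpoint Θ x)) →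
    (∀ γ : YangBaxterSAW Θ Ω δ a b, (e γ).mids = γ.mids.map E) →
    (∀ γ : YangBaxterSAW Θ Ω δ a b, (e γ).weight Θ = γ.weight Θ) →
    (ybLaw Θ Ω' δ 1 a' b').map (fun γ => γ.curve Θ δ) =
      ((ybLaw Θ Ω δ 1 a b).map (fun γ => γ.curve Θ δ)).map (CurveClass.map (F : C(ℂ, ℂ)))

/-- **S4, named.** Exact finite-volume symmetries `T_δ → S` pass to a robust limit. -/
def SymmetryPassage : Prop :=
  ∀ (α : ℝ) (P : ChordalFamily), P.IsChordal → RL α P →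
    ∀ (S : ℂ ≃ₜ ℂ) (T : ℝ → ℂ ≃ₜ ℂ) (D : DobrushinDomain) (u : ℝ → ℂ) (a b a' b' : ℝ → MidEdge),
      IsYBEndpointApprox (fun (_ : ℤ) => α) D a b →
      (∀ᶠ δ in 𝓝[>] (0 : ℝ), ‖u δ‖ ≤ δ) →
      (∀ᶠ δ in 𝓝[>] (0 : ℝ), Nonempty (YangBaxterSAW (fun (_ : ℤ) => α)
        (((D.map S).map (similarity 1 one_ne_zero (u δ))).carrier) δ (a' δ) (b' δ))) →
      (∀ (δ : ℝ) (z : ℂ), dist (T δ z) (S z) ≤ |δ|) →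
      (∀ᶠ (δ : ℝ) in 𝓝[>] (0 : ℝ),
        (δ : ℂ) * planeMidpoint (fun (_ : ℤ) => α) (a' δ) =
            T δ ((δ : ℂ) * planeMidpoint (fun (_ : ℤ) => α) (a δ)) ∧
          (δ : ℂ) * planeMidpoint (fun (_ : ℤ) => α) (b' δ) =
            T δ ((δ : ℂ) * planeMidpoint (fun (_ : ℤ) => α) (b δ))) →
      (∀ᶠ δ in 𝓝[>] (0 : ℝ),
        (ybLaw (fun (_ : ℤ) => α) (((D.map S).map (similarity 1 one_ne_zero (u δ))).carrier) δ 1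
            (a' δ) (b' δ)).map (fun γ => γ.curve (fun (_ : ℤ) => α) δ) =
          ((ybLaw (fun (_ : ℤ) => α) D.carrier δ 1 (a δ) (b δ)).map
            (fun γ => γ.curve (fun (_ : ℤ) => α) δ)).map (CurveClass.map (T δ : C(ℂ, ℂ)))) →
      P (D.map S) = (P D).map (CurveClass.map (S : C(ℂ, ℂ)))

/-- **S5, named** (= line `birth`'s `RotationOfMirrors`). Mirror covariance at every angle of
`[π/3, 2π/3]` gives covariance under every rotation about the origin. -/
def RotationOfMirrors : Prop :=
  ∀ P : ChordalFamily, (∀ α ∈ Set.Icc (Real.pi / 3) (2 * Real.pi / 3), MirrorCovariant α P) →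
    ∀ (D : DobrushinDomain) (c : ℂ) (hc : c ≠ 0), ‖c‖ = 1 →
      P (D.map (similarity c hc 0)) = (P D).map (CurveClass.map (similarity c hc 0 : C(ℂ, ℂ)))

/-! ### The stubs (the ONLY `sorry`s of this file; tree vocabulary only, no `let`, each < 3900 chars) -/

/-- **S1 — the transposition of Glazman–Manolescu's face walk** (COMBINATORIAL; size M).  For the
mid-edge transposition `E` (`vert k j ↦ slant j k`, `slant k j ↦ vert j k`), every constant angle `α`,
every face set `D` and mid-edges `a, z`: an equivalence `YBWalk D a z ≃ YBWalk (swap '' D) (E a) (E z)`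
mapping `mids` by `E` and preserving the weight `w_α`.  Route: the transposed grid complex
`gridCxᵀ α : Cx Face MidEdge` (`side f s := Face.side f (π s)`, `sideOf f e := (Face.sideOf f e).map π`,
`commonFace := MidEdge.commonFace`, `angle := α`, `π = (W S)(E N)`) is `Lawful`; `(Prod.swap, E)` is a
`Cx.Emb (gridCx α) (gridCxᵀ α) univ` (`Face.side (swap f) (π s) = E (Face.side f s)`, four cases);
`gridCxᵀ.IsWalk = gridCx.IsWalk` (only `noncross` mentions `side`, and it is symmetric in the two
straights) and `gridCxᵀ.weight = gridCx.weight` (`arcKind (π s) (π t) = arcKind s t` by `decide`,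
hence `arcKindOf`, `kindsIn` agree); conclude with `Cx.Emb.isWalk_map_iff`, `Cx.Emb.weight_map`,
`YBWalk.isWalk_mids`, `YBWalk.ofIsWalk`, `weight_gridCx`, `YBWalk.ext`; the inverse is the same map
(`E ∘ E = id`, `swap ∘ swap = id`; `D`, `a`, `z` enter `YBWalk` only through `Prop` fields). -/
theorem stub_transposeWalks :
    ∀ (E : MidEdge → MidEdge), (∀ k j : ℤ, E (MidEdge.vert k j) = MidEdge.slant j k) →
      (∀ k j : ℤ, E (MidEdge.slant k j) = MidEdge.vert j k) →
      ∀ (α : ℝ) (D : Set Face) (a z : MidEdge),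
        ∃ e : YBWalk D a z ≃ YBWalk (Prod.swap '' D) (E a) (E z),
          ∀ γ : YBWalk D a z, (e γ).mids = γ.mids.map E ∧
            (e γ).weight (fun (_ : ℤ) => α) = γ.weight (fun (_ : ℤ) => α) := by
  sorry

/-- **S2 — plane geometry of the lattice mirror** `m_{α,δ} : z ↦ e^{iα} z̄ − (iδ/2)(1 + e^{iα})`
(GEOMETRY; size S–M).  For every `α δ : ℝ`: (G1) it intertwines the rescaled mid-edge embedding with
the transposition, `δ · planeMidpoint α (E x) = m_{α,δ} (δ · planeMidpoint α x)` (constant angle: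
`colOffset α k = k • colShift`, `planeCorner α (k, j) = −i/2 + j i + k w`, `w = −i e^{iα}`, and
`m_{α,1}` swaps `i ↔ w` fixing `−i/2`); (G2) it transposes the discretisation,
`meshFaces α (m_{α,δ} Ω) δ = swap '' meshFaces α Ω δ` (`m_{α,δ} (δ z) = δ m_{α,1} z`, `m_{α,δ}` is an
involution, `m_{α,1} '' cornerSet α f = cornerSet α (swap f)` and convex hulls commute with affine
maps); (G3) `dist (m_{α,δ} z) (m_α z) = |δ| cos(α/2) ≤ |δ|`; (G4) it is affine on segments. -/
theorem stub_latticeMirrorGeometry :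
    ∀ (E : MidEdge → MidEdge), (∀ k j : ℤ, E (MidEdge.vert k j) = MidEdge.slant j k) →
      (∀ k j : ℤ, E (MidEdge.slant k j) = MidEdge.vert j k) →
      ∀ (α δ : ℝ),
        (∀ x : MidEdge, (δ : ℂ) * planeMidpoint (fun (_ : ℤ) => α) (E x) =
          (Complex.conjLIE.toHomeomorph.trans
            (similarity (Complex.exp ((α : ℂ) * Complex.I)) (Complex.exp_ne_zero _)
              (-((δ : ℂ) * Complex.I * (1 + Complex.exp ((α : ℂ) * Complex.I)) / 2))))
            ((δ : ℂ) * planeMidpoint (fun (_ : ℤ) => α) x)) ∧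
        (∀ Ω : Set ℂ, meshFaces (fun (_ : ℤ) => α)
            ((Complex.conjLIE.toHomeomorph.trans
              (similarity (Complex.exp ((α : ℂ) * Complex.I)) (Complex.exp_ne_zero _)
                (-((δ : ℂ) * Complex.I * (1 + Complex.exp ((α : ℂ) * Complex.I)) / 2)))) '' Ω) δ =
          Prod.swap '' meshFaces (fun (_ : ℤ) => α) Ω δ) ∧
        (∀ z : ℂ, dist
            ((Complex.conjLIE.toHomeomorph.trans
              (similarity (Complex.exp ((α : ℂ) * Complex.I)) (Complex.exp_ne_zero _)
                (-((δ : ℂ) * Complex.I * (1 + Complex.exp ((α : ℂ) * Complex.I)) / 2)))) z)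
            ((Complex.conjLIE.toHomeomorph.trans
              (similarity (Complex.exp ((α : ℂ) * Complex.I)) (Complex.exp_ne_zero _) 0)) z) ≤ |δ|) ∧
        (∀ (x y : ℂ) (t : ℝ),
          (Complex.conjLIE.toHomeomorph.trans
            (similarity (Complex.exp ((α : ℂ) * Complex.I)) (Complex.exp_ne_zero _)
              (-((δ : ℂ) * Complex.I * (1 + Complex.exp ((α : ℂ) * Complex.I)) / 2))))
            (AffineMap.lineMap x y t) =
          AffineMap.lineMap
            ((Complex.conjLIE.toHomeomorph.trans
              (similarity (Complex.exp ((α : ℂ) * Complex.I)) (Complex.exp_ne_zero _)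
                (-((δ : ℂ) * Complex.I * (1 + Complex.exp ((α : ℂ) * Complex.I)) / 2)))) x)
            ((Complex.conjLIE.toHomeomorph.trans
              (similarity (Complex.exp ((α : ℂ) * Complex.I)) (Complex.exp_ne_zero _)
                (-((δ : ℂ) * Complex.I * (1 + Complex.exp ((α : ℂ) * Complex.I)) / 2)))) y) t) := by
  sorry

/-- **S3 — transport of the critical finite-volume curve law** (MEASURE BOOKKEEPING; size M; the
Yang–Baxter analogue of `PinTheShear.map_curve_law_of_iso`,
`Theorems/SAWDevelopingMapHexTransferQuarterTurnCovariance.lean`).  If `e` is an equivalence of walk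
types `YBSAW_Θ(Ω_δ; a, b) ≃ YBSAW_Θ(Ω'_δ; a', b')` acting on edge lists by a map `E` and preserving the
weight `w_Θ`, and the plane homeomorphism `F` is affine on segments and intertwines the rescaled
midpoints (`δ · planeMidpoint Θ (E x) = F (δ · planeMidpoint Θ x)`), then the critical law (`x = 1`, so
the length `|γ|` does not enter: `1 ^ |γ| = 1`) of `Ω'_δ` pushed to curves is the push-forward along
`CurveClass.map F` of that of `Ω_δ`: `ybWeight` is a sum of weighted Dirac masses
(`Measure.map_sum`-type bookkeeping / `Measure.sum_comp_equiv`, equal total masses), and the polyline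
through the `F`-images is `F ∘` the polyline with the same dyadic parametrisation
(`PinTheShear.apply_polylineFrom_of_lineMap`, `CurveClass.map_mk`). -/
theorem stub_lawTransport :
    ∀ (Θ : ℤ → ℝ) (δ : ℝ) (Ω Ω' : Set ℂ) (a b a' b' : MidEdge) (E : MidEdge → MidEdge) (F : ℂ ≃ₜ ℂ)
      (e : YangBaxterSAW Θ Ω δ a b ≃ YangBaxterSAW Θ Ω' δ a' b'),
      (∀ (x y : ℂ) (t : ℝ), F (AffineMap.lineMap x y t) = AffineMap.lineMap (F x) (F y) t) →
      (∀ x : MidEdge, (δ : ℂ) * planeMidpoint Θ (E x) = F ((δ : ℂ) * planeMidpoint Θ x)) →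
      (∀ γ : YangBaxterSAW Θ Ω δ a b, (e γ).mids = γ.mids.map E) →
      (∀ γ : YangBaxterSAW Θ Ω δ a b, (e γ).weight Θ = γ.weight Θ) →
      (ybLaw Θ Ω' δ 1 a' b').map (fun γ => γ.curve Θ δ) =
        ((ybLaw Θ Ω δ 1 a b).map (fun γ => γ.curve Θ δ)).map (CurveClass.map (F : C(ℂ, ℂ))) := by
  sorry

/-- **S4 — exact finite-volume symmetries pass to robust limits** (WEAK CONVERGENCE; size M; model-
abstract: the same lemma gives translation and conjugation covariance in the sibling crux
`AxiomsOfLimit`, stmt-CriticalPhenomena-16965).  Let `P` be chordal with `RL α P`; let `S` be a plane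
homeomorphism approximated by exact lattice symmetries `T δ` (`dist (T δ z) (S z) ≤ |δ|`), realised on
a Dobrushin domain `D` with endpoint approximation `(a, b)` at angle `α` as follows: for shifts
`‖u_δ‖ ≤ δ` and endpoints `a', b'` with `δ · a'_δ = T_δ (δ · a_δ)`, `δ · b'_δ = T_δ (δ · b_δ)`
(eventually), the walk space of `(S D + u_δ)_δ` from `a'_δ` to `b'_δ` is eventually nonempty and its
critical law pushed to curves is eventually `(T_δ)_*` of that of `D_δ` from `a_δ` to `b_δ`.  Then
`P (S D) = S_* (P D)`.  Proof: the `D`-laws converge to `P D` (`RL` at `u ≡ 0`,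
`YbRelay.tendstoLaw_of_robustLimit`), hence their `S`-images to `S_* (P D)`
(`TendstoLaw.comp_continuous`) and — converging together, `PortTransfer.tendstoLaw_of_dist_le` with
`ybLaw_univ_eq_zero_or_one` — so do their `T_δ`-images, which by the law identity and `integral_map`
are the curve laws of `(S D + u_δ)_δ`; those converge to `P (S D)` by `RL` at `S D` (endpoint convergence:
`T_δ (δ a_δ) → S a = (S D).pt 0` since `δ a_δ → a`, `S` is continuous and `T_δ` is `|δ|`-close to `S`);
limits in law along `𝓝[>] 0` are unique (`tendsto_nhds_unique`,
`ext_of_forall_integral_eq_of_IsFiniteMeasure`; `P D`, `P (S D)` are probability measures). -/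
theorem stub_symmetryPassage :
    ∀ (α : ℝ) (P : ChordalFamily), P.IsChordal →
      (∀ (D : DobrushinDomain) (u : ℝ → ℂ) (a b : ℝ → MidEdge), (∀ᶠ δ in 𝓝[>] (0 : ℝ), ‖u δ‖ ≤ δ) →
        (∀ᶠ δ in 𝓝[>] (0 : ℝ), Nonempty (YangBaxterSAW (fun (_ : ℤ) => α)
          ((D.map (similarity 1 one_ne_zero (u δ))).carrier) δ (a δ) (b δ))) →
        Tendsto (fun δ : ℝ => (δ : ℂ) * planeMidpoint (fun (_ : ℤ) => α) (a δ)) (𝓝[>] (0 : ℝ))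
          (𝓝 (D.pt 0)) →
        Tendsto (fun δ : ℝ => (δ : ℂ) * planeMidpoint (fun (_ : ℤ) => α) (b δ)) (𝓝[>] (0 : ℝ))
          (𝓝 (D.pt 1)) →
        TendstoLaw (fun δ (γ : YangBaxterSAW (fun (_ : ℤ) => α)
            ((D.map (similarity 1 one_ne_zero (u δ))).carrier) δ (a δ) (b δ)) =>
            γ.curve (fun (_ : ℤ) => α) δ)
          (fun δ => ybLaw (fun (_ : ℤ) => α) ((D.map (similarity 1 one_ne_zero (u δ))).carrier) δ 1
            (a δ) (b δ)) id (P D)) →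
      ∀ (S : ℂ ≃ₜ ℂ) (T : ℝ → ℂ ≃ₜ ℂ) (D : DobrushinDomain) (u : ℝ → ℂ) (a b a' b' : ℝ → MidEdge),
        IsYBEndpointApprox (fun (_ : ℤ) => α) D a b →
        (∀ᶠ δ in 𝓝[>] (0 : ℝ), ‖u δ‖ ≤ δ) →
        (∀ᶠ δ in 𝓝[>] (0 : ℝ), Nonempty (YangBaxterSAW (fun (_ : ℤ) => α)
          (((D.map S).map (similarity 1 one_ne_zero (u δ))).carrier) δ (a' δ) (b' δ))) →
        (∀ (δ : ℝ) (z : ℂ), dist (T δ z) (S z) ≤ |δ|) →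
        (∀ᶠ (δ : ℝ) in 𝓝[>] (0 : ℝ),
          (δ : ℂ) * planeMidpoint (fun (_ : ℤ) => α) (a' δ) =
              T δ ((δ : ℂ) * planeMidpoint (fun (_ : ℤ) => α) (a δ)) ∧
            (δ : ℂ) * planeMidpoint (fun (_ : ℤ) => α) (b' δ) =
              T δ ((δ : ℂ) * planeMidpoint (fun (_ : ℤ) => α) (b δ))) →
        (∀ᶠ δ in 𝓝[>] (0 : ℝ),
          (ybLaw (fun (_ : ℤ) => α) (((D.map S).map (similarity 1 one_ne_zero (u δ))).carrier) δ 1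
              (a' δ) (b' δ)).map (fun γ => γ.curve (fun (_ : ℤ) => α) δ) =
            ((ybLaw (fun (_ : ℤ) => α) D.carrier δ 1 (a δ) (b δ)).map
              (fun γ => γ.curve (fun (_ : ℤ) => α) δ)).map (CurveClass.map (T δ : C(ℂ, ℂ)))) →
        P (D.map S) = (P D).map (CurveClass.map (S : C(ℂ, ℂ))) := by
  sorry

/-- **S5 — mirrors at all angles of `[π/3, 2π/3]` generate all rotations** (GROUP THEORY +
FUNCTORIALITY; size S–M; VERBATIM line `birth`'s `stub_rotationOfMirrors`, so one landing serves both
lines).  `m_α ∘ m_β` is the rotation by `α − β ∈ [−π/3, π/3]`, covariances compose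
(`ChordalFamily.covariant_trans`, `MarkedDomain.map_map`, `CurveClass.map_homeomorph_trans`,
`Homeomorph.ext`), and `c = e^{iθ}`, `θ = arg c ∈ (−π, π]`, is the cube of the rotation by
`θ/3 = (π/2 + θ/6) − (π/2 − θ/6)` with both angles in `[π/3, 2π/3]`. -/
theorem stub_rotationOfMirrors :
    ∀ P : ChordalFamily,
      (∀ α ∈ Set.Icc (Real.pi / 3) (2 * Real.pi / 3), ∀ D : DobrushinDomain,
        P (D.map (Complex.conjLIE.toHomeomorph.trans
            (similarity (Complex.exp ((α : ℂ) * Complex.I)) (Complex.exp_ne_zero _) 0))) =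
          (P D).map (CurveClass.map
            ((Complex.conjLIE.toHomeomorph.trans
              (similarity (Complex.exp ((α : ℂ) * Complex.I)) (Complex.exp_ne_zero _) 0) : ℂ ≃ₜ ℂ) :
              C(ℂ, ℂ)))) →
      ∀ (D : DobrushinDomain) (c : ℂ) (hc : c ≠ 0), ‖c‖ = 1 →
        P (D.map (similarity c hc 0)) = (P D).map (CurveClass.map (similarity c hc 0 : C(ℂ, ℂ))) := by
  sorry

/-! ### Consistency: each named statement IS its stub (definitionally) -/

theorem transposeWalks_holds : TransposeWalks := stub_transposeWalks
theorem latticeMirrorGeometry_holds : LatticeMirrorGeometry := stub_latticeMirrorGeometry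
theorem lawTransport_holds : LawTransport := stub_lawTransport
theorem symmetryPassage_holds : SymmetryPassage := stub_symmetryPassage
theorem rotationOfMirrors_holds : RotationOfMirrors := stub_rotationOfMirrors

/-! ### Name-keyed aliases of the five statements (device of the sibling skeletons) -/
namespace __Registered

abbrev stub_transposeWalks : Prop := TransposeWalks
abbrev stub_latticeMirrorGeometry : Prop := LatticeMirrorGeometry
abbrev stub_lawTransport : Prop := LawTransport
abbrev stub_symmetryPassage : Prop := SymmetryPassage
abbrev stub_rotationOfMirrors : Prop := RotationOfMirrors

end __Registered

/-! ### Glue (sorry-free) -/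

/-- Walk types over equal face sets are equivalent, with the same edge lists (and weights). -/
def domEquiv {D₁ D₂ : Set Face} (h : D₁ = D₂) (a z : MidEdge) : YBWalk D₁ a z ≃ YBWalk D₂ a z where
  toFun := YBWalk.mapDomain h.subset
  invFun := YBWalk.mapDomain h.symm.subset
  left_inv _ := YBWalk.ext rfl
  right_inv _ := YBWalk.ext rfl

@[simp] theorem mids_domEquiv {D₁ D₂ : Set Face} (h : D₁ = D₂) (a z : MidEdge) (γ : YBWalk D₁ a z) :
    (domEquiv h a z γ).mids = γ.mids := rfl

@[simp] theorem weight_domEquiv {D₁ D₂ : Set Face} (h : D₁ = D₂) (a z : MidEdge) (Θ : ℤ → ℝ)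
    (γ : YBWalk D₁ a z) : (domEquiv h a z γ).weight Θ = γ.weight Θ := rfl

/-- The shifted mirrored domain is the lattice-mirrored domain: `(m_α D) + δ c_α = m_{α,δ} D`. -/
theorem carrier_target (D : DobrushinDomain) (α δ : ℝ) :
    ((D.map (mirror α)).map (similarity 1 one_ne_zero ((δ : ℂ) * offset α))).carrier =
      latticeMirror α δ '' D.carrier := by
  rw [MarkedDomain.carrier_map, MarkedDomain.carrier_map, Set.image_image]
  refine Set.image_congr fun z _ => ?_
  simp only [Homeomorph.trans_apply, similarity_apply, offset]
  ring

/-- `‖c_α‖ ≤ 1`. -/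
theorem norm_offset_le (α : ℝ) : ‖offset α‖ ≤ 1 := by
  have h1 : ‖Complex.exp ((α : ℂ) * Complex.I)‖ = 1 := Complex.norm_exp_ofReal_mul_I α
  have h2 : ‖(1 : ℂ) + Complex.exp ((α : ℂ) * Complex.I)‖ ≤ 2 := by
    calc ‖(1 : ℂ) + Complex.exp ((α : ℂ) * Complex.I)‖
        ≤ ‖(1 : ℂ)‖ + ‖Complex.exp ((α : ℂ) * Complex.I)‖ := norm_add_le _ _
      _ = 2 := by rw [h1, norm_one]; norm_num
  unfold offset
  rw [norm_neg, norm_div, norm_mul, Complex.norm_I, one_mul, Complex.norm_ofNat]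
  linarith

/-- **Mirror covariance at one angle** from S1–S4: the per-mesh equivalence of walk types
`YBSAW_α(D; a, b) ≃ YBSAW_α(m_α D + δ c_α; E a, E b)` (S1 at `(D.carrier)_δ`, S2 (G2), `carrier_target`),
the law identity (S3 with `F = m_{α,δ}`, S2 (G1), (G4)), and the passage (S4 with `S = m_α`,
`T_δ = m_{α,δ}`, `u_δ = δ c_α`; S2 (G3), `norm_offset_le`). -/
theorem mirrorCovariant_of (h1 : TransposeWalks) (h2 : LatticeMirrorGeometry) (h3 : LawTransport)
    (h4 : SymmetryPassage) (α : ℝ) {P : ChordalFamily} (hP : P.IsChordal) (hRL : RL α P)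
    (hEA : ∀ D : DobrushinDomain, ∃ a b : ℝ → MidEdge, IsYBEndpointApprox (fun (_ : ℤ) => α) D a b) :
    MirrorCovariant α P := by
  intro D
  obtain ⟨a, b, hab⟩ := hEA D
  have hG := fun δ : ℝ => h2 tEdge (fun _ _ => rfl) (fun _ _ => rfl) α δ
  -- the per-mesh equivalence of walk types
  have key : ∀ δ : ℝ, ∃ e : YangBaxterSAW (fun (_ : ℤ) => α) D.carrier δ (a δ) (b δ) ≃
      YangBaxterSAW (fun (_ : ℤ) => α)
        (((D.map (mirror α)).map (similarity 1 one_ne_zero ((δ : ℂ) * offset α))).carrier) δ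
        (tEdge (a δ)) (tEdge (b δ)),
      (∀ γ, (e γ).mids = γ.mids.map tEdge) ∧
        ∀ γ, (e γ).weight (fun (_ : ℤ) => α) = γ.weight (fun (_ : ℤ) => α) := by
    intro δ
    obtain ⟨e₁, he₁⟩ := h1 tEdge (fun _ _ => rfl) (fun _ _ => rfl) α
      (meshFaces (fun (_ : ℤ) => α) D.carrier δ) (a δ) (b δ)
    have hset : meshFaces (fun (_ : ℤ) => α)
        (((D.map (mirror α)).map (similarity 1 one_ne_zero ((δ : ℂ) * offset α))).carrier) δ =
        Prod.swap '' meshFaces (fun (_ : ℤ) => α) D.carrier δ := by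
      rw [carrier_target]
      exact (hG δ).2.1 D.carrier
    refine ⟨e₁.trans (domEquiv hset.symm _ _), fun γ => ?_, fun γ => ?_⟩
    · rw [Equiv.trans_apply, mids_domEquiv]
      exact (he₁ γ).1
    · rw [Equiv.trans_apply, weight_domEquiv]
      exact (he₁ γ).2
  choose eqv heqv_mids heqv_wt using key
  refine h4 α P hP hRL (mirror α) (fun δ => latticeMirror α δ) D (fun δ => (δ : ℂ) * offset α) a b
    (fun δ => tEdge (a δ)) (fun δ => tEdge (b δ)) hab ?_ ?_ (fun δ z => (hG δ).2.2.1 z) ?_ ?_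
  · -- `‖δ c_α‖ ≤ δ`
    filter_upwards [self_mem_nhdsWithin] with δ hδ
    rw [norm_mul, Complex.norm_real, Real.norm_eq_abs, abs_of_pos (Set.mem_Ioi.1 hδ)]
    exact mul_le_of_le_one_right (le_of_lt (Set.mem_Ioi.1 hδ)) (norm_offset_le α)
  · -- the mirrored walk spaces are eventually nonempty
    filter_upwards [hab.nonempty] with δ hδ
    obtain ⟨γ⟩ := hδ
    exact ⟨eqv δ γ⟩
  · -- the mirrored endpoints are intertwined by `m_{α,δ}`
    exact Eventually.of_forall fun δ => ⟨(hG δ).1 (a δ), (hG δ).1 (b δ)⟩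
  · -- the finite-volume law identity
    exact Eventually.of_forall fun δ =>
      h3 (fun (_ : ℤ) => α) δ D.carrier _ (a δ) (b δ) (tEdge (a δ)) (tEdge (b δ)) tEdge
        (latticeMirror α δ) (eqv δ) ((hG δ).2.2.2) ((hG δ).1) (heqv_mids δ) (heqv_wt δ)

/-! ### The skeleton theorem: the five stubs imply the crux, BY NAME -/

/-- **`MirrorRotation` from the line `grid_transpose`** (kernel-checked, no `sorry` of its own). -/
theorem MirrorRotation_of (h1 : __Registered.stub_transposeWalks)
    (h2 : __Registered.stub_latticeMirrorGeometry) (h3 : __Registered.stub_lawTransport)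
    (h4 : __Registered.stub_symmetryPassage) (h5 : __Registered.stub_rotationOfMirrors) :
    Summit.CriticalPhenomena.SAWScalingLimit.Theses.SAWTrackTransport.MirrorRotation := by
  intro hAU hEP P hP hRL D c hc hc1
  refine h5 P (fun α hα => ?_) D c hc hc1
  exact mirrorCovariant_of h1 h2 h3 h4 α hP (hAU α hα P hP hRL) (hEP α hα)

/-- Wiring check (an `example`, so that `MirrorRotation_of` stays the only theorem concluding the crux). -/
example : Summit.CriticalPhenomena.SAWScalingLimit.Theses.SAWTrackTransport.MirrorRotation :=
  MirrorRotation_of stub_transposeWalks stub_latticeMirrorGeometry stub_lawTransport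
    stub_symmetryPassage stub_rotationOfMirrors

end Summit.CriticalPhenomena.SAWScalingLimit.Cruxes.MirrorRotation.GridTranspose

end
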